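import Literature.Analysis.FluidPDE.PassiveScalarEnergySlice
import Literature.Analysis.FluidPDE.PassiveScalarEnergyMollified
import Literature.Analysis.FunctionSpaces.TorusFourierConvolution
import HarnessLib

/-!
# Two spectral facts about weak solutions of the passive scalar equation

Analysis/FluidPDE proof-support file (everything proved).

* `Torus.enorm_integral_mul_laplacian_le` — **the `Ḣ¹ × Ḣ¹` pairing bound**
  `‖∫ θ Δφ‖ₑ ≤ (eScalarGradNormSq θ)^{1/2} (eScalarGradNormSq φ)^{1/2}` for `θ ∈ L²(T^d)` and
  smooth `φ` (Parseval, `𝓕(Δφ)(k) = -4π²|k|² φ̂(k)`, Cauchy–Schwarz in `ℓ²`); with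
  `eScalarGradNormSq φ = ∫ ‖∇φ‖²` for smooth `φ` this is the diffusion term
  `κ ∫ θ Δ(ζ ⋆ k_ε) ≤ κ ‖∇(ζ ⋆ k_ε)‖_{L²} ‖∇θ‖_{L²}` of Seis 2022, Lemma 3;
* `Torus.IsWeakScalarTransportOn.aemeasurable_eScalarGradNormSq` — `s ↦ ‖∇θ(s)‖²_{L²}` (spectral)
  is a.e.-measurable on `(0,T)` (each Fourier coefficient `s ↦ 𝓕(θ(s))(k)` is a parametric
  integral of a jointly measurable integrand; countable `ℝ≥0∞` sums).

## References

* C. Seis, Comm. Math. Phys. 2022 (arXiv:2003.08794), Lemma 3. [`Seis2022`]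
* L. Grafakos, *Classical Fourier Analysis* (2014), Prop. 3.1.2 (10), Prop. 3.2.7 (3).
-/

noncomputable section

open MeasureTheory TopologicalSpace Set Function Filter Topology Metric UnitAddTorus
open scoped ENNReal NNReal Convolution ContDiff InnerProductSpace ComplexConjugate

namespace Literature.Analysis.FluidPDE

namespace Torus

variable {d : Type*} [Fintype d]

/-! ## The `Ḣ¹ × Ḣ¹` pairing bound -/

/-- Cauchy–Schwarz for `ℝ≥0∞`-valued series: `∑ aₖ bₖ ≤ (∑ aₖ²)^{1/2} (∑ bₖ²)^{1/2}`
(Hölder on the counting measure). [folklore] -/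
theorem _root_.Literature.Analysis.FluidPDE.ennreal_tsum_mul_le_sqrt_mul_sqrt {ι : Type*} [Countable ι]
    (a b : ι → ℝ≥0∞) :
    ∑' k, a k * b k ≤ (∑' k, a k ^ 2) ^ (1 / 2 : ℝ) * (∑' k, b k ^ 2) ^ (1 / 2 : ℝ) := by
  letI : MeasurableSpace ι := ⊤
  haveI : MeasurableSingletonClass ι := ⟨fun _ => trivial⟩
  have h := ENNReal.lintegral_mul_le_Lp_mul_Lq (Measure.count : Measure ι) Real.HolderConjugate.two_two
    (f := a) (g := b) (Measurable.of_discrete.aemeasurable) (Measurable.of_discrete.aemeasurable)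
  rw [lintegral_count, lintegral_count, lintegral_count] at h
  have e1 : ∑' k, a k ^ (2 : ℝ) = ∑' k, a k ^ 2 := tsum_congr fun k => ENNReal.rpow_two _
  have e2 : ∑' k, b k ^ (2 : ℝ) = ∑' k, b k ^ 2 := tsum_congr fun k => ENNReal.rpow_two _
  rw [e1, e2] at h
  simpa using h

/-- `eScalarGradNormSq θ = ∑ₖ (4π²|k|²) ‖θ̂(k)‖ₑ²` with the weight inside the sum. [folklore] -/
theorem eScalarGradNormSq_eq_tsum' (θ : UnitAddTorus d → ℝ) :
    eScalarGradNormSq θ = ∑' k : d → ℤ,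
      (ENNReal.ofReal (4 * Real.pi ^ 2 * FunctionSpaces.Torus.freqNormSq k) ^ (1 / 2 : ℝ) *
        ‖mFourierCoeff (fun x => (θ x : ℂ)) k‖ₑ) ^ 2 := by
  rw [eScalarGradNormSq_eq_tsum, ← ENNReal.tsum_mul_left]
  refine tsum_congr fun k => ?_
  rw [mul_pow]
  have e : (ENNReal.ofReal (4 * Real.pi ^ 2 * FunctionSpaces.Torus.freqNormSq k) ^ (1 / 2 : ℝ)) ^ 2 =
      ENNReal.ofReal (4 * Real.pi ^ 2 * FunctionSpaces.Torus.freqNormSq k) := by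
    rw [← ENNReal.rpow_natCast, ← ENNReal.rpow_mul]
    norm_num
  rw [e, show ENNReal.ofReal (4 * Real.pi ^ 2 * FunctionSpaces.Torus.freqNormSq k) =
      ENNReal.ofReal (4 * Real.pi ^ 2) * ENNReal.ofReal (FunctionSpaces.Torus.freqNormSq k) from
    ENNReal.ofReal_mul (by positivity), mul_assoc]

/-- **The `Ḣ¹ × Ḣ¹` pairing bound**: for `θ ∈ L²(T^d)` and smooth `φ`,
`‖∫ θ Δφ‖ₑ ≤ (eScalarGradNormSq θ)^{1/2} (eScalarGradNormSq φ)^{1/2}`. [folklore] -/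
theorem enorm_integral_mul_laplacian_le {θ φ : UnitAddTorus d → ℝ} (hθ : MemLp θ 2 volume)
    (hφ : FunctionSpaces.Torus.IsSmooth φ) :
    ‖∫ x, θ x * FunctionSpaces.Torus.laplacian φ x‖ₑ ≤
      eScalarGradNormSq θ ^ (1 / 2 : ℝ) * eScalarGradNormSq φ ^ (1 / 2 : ℝ) := by
  -- complexify and apply the polarised Parseval identity
  set g : UnitAddTorus d → ℂ := fun x => (θ x : ℂ) with hg
  set w : UnitAddTorus d → ℂ := fun x => (φ x : ℂ) with hw
  have hwS : FunctionSpaces.Torus.IsSmooth w := hφ.ofReal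
  have hgm : MemLp g 2 volume := hθ.ofReal
  have hΔm : MemLp (FunctionSpaces.Torus.laplacian w) 2 volume := by
    obtain ⟨C, hC⟩ := FunctionSpaces.Torus.exists_forall_norm_le_of_continuous hwS.laplacian.continuous
    exact (memLp_top_of_bound hwS.laplacian.continuous.aestronglyMeasurable C (Eventually.of_forall hC)).mono_exponent
      le_top
  have hP := FunctionSpaces.Torus.hasSum_conj_mul_mFourierCoeff hgm hΔm
  -- the real pairing as the complex one
  have hI : ((∫ x, θ x * FunctionSpaces.Torus.laplacian φ x : ℝ) : ℂ) =
      ∫ x, conj (g x) * FunctionSpaces.Torus.laplacian w x := by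
    rw [← integral_complex_ofReal]
    refine integral_congr_ae (Eventually.of_forall fun x => ?_)
    simp only [hg, hw, Complex.conj_ofReal, Complex.ofReal_mul]
    rw [FunctionSpaces.Torus.ofReal_laplacian hφ x]
  -- the coefficients
  set c : (d → ℤ) → ℝ≥0∞ := fun k => ENNReal.ofReal (4 * Real.pi ^ 2 * FunctionSpaces.Torus.freqNormSq k) with hc
  have hterm : ∀ k, ‖conj (mFourierCoeff g k) * mFourierCoeff (FunctionSpaces.Torus.laplacian w) k‖ₑ =
      (c k ^ (1 / 2 : ℝ) * ‖mFourierCoeff g k‖ₑ) * (c k ^ (1 / 2 : ℝ) * ‖mFourierCoeff w k‖ₑ) := by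
    intro k
    rw [FunctionSpaces.Torus.mFourierCoeff_laplacian_complex hwS, enorm_mul, enorm_mul, RCLike.enorm_conj, enorm_neg]
    have e1 : ‖((4 * Real.pi ^ 2 * FunctionSpaces.Torus.freqNormSq k : ℝ) : ℂ)‖ₑ = c k := by
      rw [← ofReal_norm, Complex.norm_real, Real.norm_eq_abs,
        abs_of_nonneg (by have := FunctionSpaces.Torus.freqNormSq_nonneg k; positivity)]
    rw [e1]
    have e2 : c k ^ (1 / 2 : ℝ) * c k ^ (1 / 2 : ℝ) = c k := by
      rw [← ENNReal.rpow_add_of_nonneg _ _ (by norm_num) (by norm_num)]; norm_num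
    calc ‖mFourierCoeff g k‖ₑ * (c k * ‖mFourierCoeff w k‖ₑ)
        = (c k ^ (1 / 2 : ℝ) * c k ^ (1 / 2 : ℝ)) * ‖mFourierCoeff g k‖ₑ * ‖mFourierCoeff w k‖ₑ := by rw [e2]; ring
      _ = _ := by ring
  calc ‖∫ x, θ x * FunctionSpaces.Torus.laplacian φ x‖ₑ
      = ‖((∫ x, θ x * FunctionSpaces.Torus.laplacian φ x : ℝ) : ℂ)‖ₑ := by
        rw [← ofReal_norm, ← ofReal_norm, Complex.norm_real]
    _ = ‖∑' k, conj (mFourierCoeff g k) * mFourierCoeff (FunctionSpaces.Torus.laplacian w) k‖ₑ := by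
        rw [hI, hP.tsum_eq]
    _ ≤ ∑' k, ‖conj (mFourierCoeff g k) * mFourierCoeff (FunctionSpaces.Torus.laplacian w) k‖ₑ :=
        enorm_tsum_le_tsum_enorm
    _ = ∑' k, (c k ^ (1 / 2 : ℝ) * ‖mFourierCoeff g k‖ₑ) * (c k ^ (1 / 2 : ℝ) * ‖mFourierCoeff w k‖ₑ) :=
        tsum_congr hterm
    _ ≤ (∑' k, (c k ^ (1 / 2 : ℝ) * ‖mFourierCoeff g k‖ₑ) ^ 2) ^ (1 / 2 : ℝ) *
          (∑' k, (c k ^ (1 / 2 : ℝ) * ‖mFourierCoeff w k‖ₑ) ^ 2) ^ (1 / 2 : ℝ) :=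
        ennreal_tsum_mul_le_sqrt_mul_sqrt _ _
    _ = eScalarGradNormSq θ ^ (1 / 2 : ℝ) * eScalarGradNormSq φ ^ (1 / 2 : ℝ) := by
        rw [← eScalarGradNormSq_eq_tsum' θ, ← eScalarGradNormSq_eq_tsum' φ]

/-- The diffusion pairing against a smooth function with `‖∇φ‖ ≤ L`:
`‖∫ θ Δφ‖ₑ ≤ L · (eScalarGradNormSq θ)^{1/2}`. [folklore] -/
theorem enorm_integral_mul_laplacian_le_of_norm_gradient_le {θ φ : UnitAddTorus d → ℝ} (hθ : MemLp θ 2 volume)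
    (hφ : FunctionSpaces.Torus.IsSmooth φ) {L : ℝ} (hL : ∀ x, ‖FunctionSpaces.Torus.gradient φ x‖ ≤ L) :
    ‖∫ x, θ x * FunctionSpaces.Torus.laplacian φ x‖ₑ ≤ ENNReal.ofReal L * eScalarGradNormSq θ ^ (1 / 2 : ℝ) := by
  have hL0 : 0 ≤ L := (norm_nonneg _).trans (hL 0)
  refine (enorm_integral_mul_laplacian_le hθ hφ).trans ?_
  rw [mul_comm]
  refine mul_le_mul' ?_ le_rfl
  rw [eScalarGradNormSq_eq_ofReal_integral hφ, ENNReal.ofReal_rpow_of_nonneg (integral_nonneg fun _ => sq_nonneg _)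
    (by norm_num)]
  refine ENNReal.ofReal_le_ofReal ?_
  have h1 : ∫ x, ‖FunctionSpaces.Torus.gradient φ x‖ ^ 2 ≤ L ^ 2 := by
    calc ∫ x, ‖FunctionSpaces.Torus.gradient φ x‖ ^ 2 ≤ ∫ _ : UnitAddTorus d, L ^ 2 :=
          integral_mono (hφ.gradient.continuous.norm.pow 2).integrable_unitAddTorus (integrable_const _)
            fun x => pow_le_pow_left₀ (norm_nonneg _) (hL x) 2
      _ = L ^ 2 := by simp
  calc (∫ x, ‖FunctionSpaces.Torus.gradient φ x‖ ^ 2) ^ (1 / 2 : ℝ) ≤ (L ^ 2) ^ (1 / 2 : ℝ) :=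
        Real.rpow_le_rpow (integral_nonneg fun _ => sq_nonneg _) h1 (by norm_num)
    _ = L := by
        rw [← Real.sqrt_eq_rpow, Real.sqrt_sq hL0]

/-! ## Measurability in time of the spectral gradient norm of a weak solution -/

namespace IsWeakScalarTransportOn

variable {T κ : ℝ} {u : ℝ → UnitAddTorus d → EuclideanSpace ℝ d} {θ₀ : UnitAddTorus d → ℝ}
  {θ : ℝ → UnitAddTorus d → ℝ}

/-- Each Fourier coefficient `s ↦ 𝓕(θ(s))(k)` of a weak solution is a.e.-strongly measurable on
`(0,T)`. [folklore] -/
theorem aestronglyMeasurable_mFourierCoeff (h : IsWeakScalarTransportOn T κ u θ₀ θ) (k : d → ℤ) :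
    AEStronglyMeasurable (fun s => mFourierCoeff (fun x => (θ s x : ℂ)) k)
      ((volume : Measure ℝ).restrict (Ioo 0 T)) := by
  have e : (fun s => mFourierCoeff (fun x => (θ s x : ℂ)) k) = fun s => ∫ x, mFourier (-k) x • (θ s x : ℂ) := by
    funext s
    exact FunctionSpaces.Torus.mFourierCoeff_eq_integral_volume _ k
  rw [e]
  have hm : AEStronglyMeasurable (uncurry fun s x => mFourier (-k) x • (θ s x : ℂ))
      (((volume : Measure ℝ).restrict (Ioo 0 T)).prod volume) :=
    ((mFourier (-k)).continuous.comp continuous_snd).aestronglyMeasurable.smul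
      (Complex.continuous_ofReal.comp_aestronglyMeasurable h.aestronglyMeasurable_uncurry)
  exact hm.integral_prod_right'

/-- **`s ↦ eScalarGradNormSq (θ s)` is a.e.-measurable on `(0,T)`** for a weak solution. [folklore] -/
theorem aemeasurable_eScalarGradNormSq (h : IsWeakScalarTransportOn T κ u θ₀ θ) :
    AEMeasurable (fun s => eScalarGradNormSq (θ s)) ((volume : Measure ℝ).restrict (Ioo 0 T)) := by
  have e : (fun s => eScalarGradNormSq (θ s)) = fun s => ENNReal.ofReal (4 * Real.pi ^ 2) *
      ∑' k : d → ℤ, ENNReal.ofReal (FunctionSpaces.Torus.freqNormSq k) * ‖mFourierCoeff (fun x => (θ s x : ℂ)) k‖ₑ ^ 2 := by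
    funext s
    exact eScalarGradNormSq_eq_tsum (θ s)
  rw [e]
  refine AEMeasurable.const_mul (AEMeasurable.tsum fun k => ?_) _
  exact ((h.aestronglyMeasurable_mFourierCoeff k).enorm.pow_const 2).const_mul _

end IsWeakScalarTransportOn

end Torus

end Literature.Analysis.FluidPDE
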